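import Literature.AlgebraicGeometry.Motives.AbelianVarietyPoincareSplitting
import Mathlib.Algebra.Polynomial.Derivative
import Mathlib.Algebra.Polynomial.AlgebraMap
import Mathlib.Algebra.Ring.GeomSum
import HarnessLib

/-!
# Equivariant quasi-retractions for a pair of endomorphisms with a common separable polynomial

Sequel of `Motives/AbelianVarietyPoincareSplitting` and `Motives/AbelianVarietyPoincareEquivariant`
(any ground field `K`). Let `u ∈ End X`, `u' ∈ End Y` be endomorphisms of abelian varieties
intertwined by `i : Y ⟶ X` (`i ≫ u = u' ≫ i`) and annihilated by a monic-or-not integer polynomial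
`f ∈ ℤ[T]` (`f(u) = 0`, `f(u') = 0`) which is SEPARABLE in the integral sense that
`c_u f + c_v f' = D` for some `c_u, c_v ∈ ℤ[T]` and an integer `D ≠ 0` (e.g. `f` the minimal
polynomial of a generator `α` of an order `ℤ[α]` of a number field acting on `X` and `Y` by complex
multiplication, `D` a multiple of `disc f`). Then every quasi-retraction `h` of `i`
(`i ≫ h = N • 𝟙 Y`) can be replaced by one COMMUTING with `u, u'`:

* `AbelianVariety.exists_equivariant_quasiRetraction_of_aeval_eq_zero` — there is `h̃ : X ⟶ Y`
  with `i ≫ h̃ = (N D) • 𝟙 Y` and `u ≫ h̃ = h̃ ≫ u'`.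

Construction (the separability idempotent of `ℤ[T]/(f)` made explicit, cf. Pierce, *Associative
Algebras*, §10.2, and the Euler form `(f(S) - f(T))/(S - T)` of the different): on
`V = Hom(X, Y)` the commuting operators `A g = u ≫ g`, `B g = g ≫ u'` satisfy `f(A) = f(B) = 0`;
with `E_m = ∑_{j<m} A^j B^{m-1-j}` one has `E_m (A - B) = A^m - B^m`
(Mathlib `Commute.geom_sum₂_mul`), so `P = ∑_m f_m E_m` satisfies `(A - B) P = f(A) - f(B) = 0`:
`P h` commutes with `u, u'` for every `h`. If `i ≫ h = N • 𝟙` then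
`i ≫ P h = N • ∑_m m f_m u'^{m-1} = N • f'(u')`, and `h̃ = P h ≫ c_v(u')` has
`i ≫ h̃ = N • (c_v f')(u') = N • (D - c_u f)(u') = (N D) • 𝟙`.

With `Motives/AbelianVarietyPoincareSplitting` (`exists_complement_of_quasiRetraction`,
`comp_complementEndo_of_equivariant` of `Motives/AbelianVarietyPoincareEquivariant`) this yields
Poincaré complements stable under a CM order `ℤ[α]` — and hence under any order `𝓞 ⊇ ℤ[α]` of the
same field acting compatibly, `Hom` being torsion-free
(`AbelianVariety.comp_eq_comp_of_nsmul_generator`). Everything is proved; no definition, no named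
fact (D-0026).

## References

* R. S. Pierce, *Associative Algebras*, GTM 88 (1982), §10.2 (separability idempotents; the
  projection onto centralisers / bimodule maps). [Pierce1982]
* D. Mumford, *Abelian Varieties* (1970), §19 Thm. 1 and proof of Cor. 2 (pp. 173–174), Thm. 3
  (`Hom` is torsion-free). [MumfordAV1970]
* H. Lange, R. E. Rodríguez, *Decomposition of Jacobians by Prym Varieties* (2022), Thm. 2.7.1
  (Poincaré reducibility with a group action — the finite-group analogue). [LangeRodriguez2022]
-/

noncomputable section

universe u

open CategoryTheory CategoryTheory.Limits AlgebraicGeometry Polynomial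
open scoped Polynomial

namespace Literature.AlgebraicGeometry.Motives

namespace AbelianVariety

variable {K : Type u} [Field K] {X Y : AbelianVariety K}

/-! ### Powers of endomorphisms as morphisms -/

/-- `u^{n+1} ≫ g = u^n ≫ (u ≫ g)` (composition in `End` is reversed multiplication). [folklore] -/
private theorem asHom_pow_succ_comp {Z : AbelianVariety K} (u : End X) (n : ℕ) (g : X ⟶ Z) :
    End.asHom (u ^ (n + 1)) ≫ g = End.asHom (u ^ n) ≫ (End.asHom u ≫ g) := by
  rw [pow_succ', ← Category.assoc]
  rfl

/-- `g ≫ u'^{n+1} = (g ≫ u') ≫ u'^n`. [folklore] -/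
private theorem comp_asHom_pow_succ {Z : AbelianVariety K} (u' : End Y) (n : ℕ) (g : Z ⟶ Y) :
    g ≫ End.asHom (u' ^ (n + 1)) = (g ≫ End.asHom u') ≫ End.asHom (u' ^ n) := by
  rw [pow_succ, Category.assoc]
  rfl

/-- `u'^j ≫ u'^k = u'^{k+j}` as morphisms. [folklore] -/
private theorem asHom_pow_comp_asHom_pow (u' : End Y) (j k : ℕ) :
    End.asHom (u' ^ j) ≫ End.asHom (u' ^ k) = End.asHom (u' ^ (k + j)) := by
  rw [pow_add]
  rfl

/-- An intertwining `i ≫ u = u' ≫ i` extends to all powers. [folklore] -/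
private theorem comp_asHom_pow_of_comp_eq {i : Y ⟶ X} {u : End X} {u' : End Y}
    (hi : i ≫ End.asHom u = End.asHom u' ≫ i) (n : ℕ) :
    i ≫ End.asHom (u ^ n) = End.asHom (u' ^ n) ≫ i := by
  induction n with
  | zero => simp only [pow_zero]; exact (Category.comp_id i).trans (Category.id_comp i).symm
  | succ n ih =>
    rw [pow_succ, pow_succ]
    change i ≫ (End.asHom u ≫ End.asHom (u ^ n)) = (End.asHom u' ≫ End.asHom (u' ^ n)) ≫ i
    rw [← Category.assoc, hi, Category.assoc, ih, Category.assoc]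

/-- `p(u') ≫ u' = u' ≫ p(u')` for a polynomial `p`. [folklore] -/
private theorem asHom_aeval_comp_asHom (u' : End Y) (p : ℤ[X]) :
    End.asHom (aeval u' p) ≫ End.asHom u' = End.asHom u' ≫ End.asHom (aeval u' p) := by
  have e : aeval u' p * u' = u' * aeval u' p := by
    have h1 : aeval u' (p * Polynomial.X) = aeval u' (Polynomial.X * p) := by rw [mul_comm]
    simpa only [map_mul, aeval_X] using h1
  change u' * aeval u' p = aeval u' p * u'
  exact e.symm

/-! ### The operators `g ↦ u ≫ g` and `g ↦ g ≫ u'` on `Hom` and polynomials in them -/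

section Operators

variable {Z : AbelianVariety K}

/-- Powers of the operator `L_u : g ↦ u ≫ g` on `Hom(X, Z)`: `L_u^n g = u^n ≫ g`. [folklore] -/
private theorem leftComp_pow_apply (u : End X) (n : ℕ) (g : X ⟶ Z) :
    (((Preadditive.leftComp Z (End.asHom u)).toIntLinearMap : Module.End ℤ (X ⟶ Z)) ^ n) g =
      End.asHom (u ^ n) ≫ g := by
  induction n generalizing g with
  | zero => rw [pow_zero, pow_zero, Module.End.one_apply]; exact (Category.id_comp g).symm
  | succ n ih => rw [pow_succ, Module.End.mul_apply, ih, asHom_pow_succ_comp]; rfl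

/-- Powers of the operator `R_{u'} : g ↦ g ≫ u'` on `Hom(Z, Y)`: `R_{u'}^n g = g ≫ u'^n`. [folklore] -/
private theorem rightComp_pow_apply (u' : End Y) (n : ℕ) (g : Z ⟶ Y) :
    (((Preadditive.rightComp Z (End.asHom u')).toIntLinearMap : Module.End ℤ (Z ⟶ Y)) ^ n) g =
      g ≫ End.asHom (u' ^ n) := by
  induction n generalizing g with
  | zero => rw [pow_zero, pow_zero, Module.End.one_apply]; exact (Category.comp_id g).symm
  | succ n ih => rw [pow_succ, Module.End.mul_apply, ih, comp_asHom_pow_succ]; rfl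

/-- Polynomials in `L_u` act as `p(u) ≫ ·`. [folklore] -/
private theorem aeval_leftComp_apply (u : End X) (p : ℤ[X]) (g : X ⟶ Z) :
    (aeval ((Preadditive.leftComp Z (End.asHom u)).toIntLinearMap : Module.End ℤ (X ⟶ Z)) p) g =
      End.asHom (aeval u p) ≫ g := by
  induction p using Polynomial.induction_on' with
  | add p q hp hq =>
    rw [map_add, map_add, LinearMap.add_apply, hp, hq]
    change _ = (End.asHom (aeval u p) + End.asHom (aeval u q)) ≫ g
    rw [Preadditive.add_comp]
  | monomial n c =>
    rw [aeval_monomial, aeval_monomial, Module.End.mul_apply, leftComp_pow_apply,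
      Module.algebraMap_end_apply, Algebra.algebraMap_eq_smul_one, smul_mul_assoc, one_mul]
    change _ = (c • End.asHom (u ^ n)) ≫ g
    rw [Preadditive.zsmul_comp]

/-- Polynomials in `R_{u'}` act as `· ≫ p(u')`. [folklore] -/
private theorem aeval_rightComp_apply (u' : End Y) (p : ℤ[X]) (g : Z ⟶ Y) :
    (aeval ((Preadditive.rightComp Z (End.asHom u')).toIntLinearMap : Module.End ℤ (Z ⟶ Y)) p) g =
      g ≫ End.asHom (aeval u' p) := by
  induction p using Polynomial.induction_on' with
  | add p q hp hq =>
    rw [map_add, map_add, LinearMap.add_apply, hp, hq]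
    change _ = g ≫ (End.asHom (aeval u' p) + End.asHom (aeval u' q))
    rw [Preadditive.comp_add]
  | monomial n c =>
    rw [aeval_monomial, aeval_monomial, Module.End.mul_apply, rightComp_pow_apply,
      Module.algebraMap_end_apply, Algebra.algebraMap_eq_smul_one, smul_mul_assoc, one_mul]
    change _ = g ≫ (c • End.asHom (u' ^ n))
    rw [Preadditive.comp_zsmul]

/-- `p(u')` as a `Hom`-valued sum: `p(u') = ∑_{k<n} p_k • u'^k` for `natDegree p < n`. [folklore] -/
private theorem asHom_aeval_eq_sum (u' : End Y) (p : ℤ[X]) {n : ℕ} (hn : p.natDegree < n) :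
    End.asHom (aeval u' p) = ∑ k ∈ Finset.range n, p.coeff k • End.asHom (u' ^ k) := by
  have e := aeval_rightComp_apply (Z := Y) u' p (𝟙 Y)
  rw [Category.id_comp, aeval_eq_sum_range' hn, LinearMap.sum_apply] at e
  rw [← e]
  refine Finset.sum_congr rfl fun k _ ↦ ?_
  rw [LinearMap.smul_apply, rightComp_pow_apply, Category.id_comp]

end Operators

/-! ### The equivariant quasi-retraction -/

/-- **Equivariant quasi-retraction for endomorphisms with a common separable integral polynomial.**
Let `u ∈ End X`, `u' ∈ End Y` be intertwined by `i : Y ⟶ X` (`i ≫ u = u' ≫ i`), let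
`f, c_u, c_v ∈ ℤ[T]` and `D ∈ ℤ` with `f(u) = 0`, `f(u') = 0` and `c_u f + c_v f' = D`, and let
`h` be a quasi-retraction of `i`, `i ≫ h = N • 𝟙 Y`. Then there is `h̃ : X ⟶ Y` with
`i ≫ h̃ = (N D) • 𝟙 Y` and `u ≫ h̃ = h̃ ≫ u'` — namely `h̃ = P h ≫ c_v(u')`,
`P = ∑_m f_m ∑_{j<m} A^j B^{m-1-j}` for `A = (u ≫ ·)`, `B = (· ≫ u')` (the separability
idempotent of `ℤ[T]/(f)` up to the factor `D`). [cite: Pierce1982, §10.2]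
[cite: MumfordAV1970, §19 Thm. 1 and proof of Cor. 2 (pp. 173–174)] -/
theorem exists_equivariant_quasiRetraction_of_aeval_eq_zero (u : End X) (u' : End Y)
    {i : Y ⟶ X} {h : X ⟶ Y} {N : ℕ} (hi : i ≫ End.asHom u = End.asHom u' ≫ i)
    (hih : i ≫ h = N • 𝟙 Y) (f cu cv : ℤ[X]) (D : ℤ) (hf : aeval u f = 0) (hf' : aeval u' f = 0)
    (hD : cu * f + cv * derivative f = C D) :
    ∃ h' : X ⟶ Y, i ≫ h' = ((N : ℤ) * D) • 𝟙 Y ∧ End.asHom u ≫ h' = h' ≫ End.asHom u' := by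
  classical
  -- the commuting operators `A = (u ≫ ·)`, `B = (· ≫ u')` on `V = Hom(X, Y)`
  let A : Module.End ℤ (X ⟶ Y) := (Preadditive.leftComp Y (End.asHom u)).toIntLinearMap
  let B : Module.End ℤ (X ⟶ Y) := (Preadditive.rightComp X (End.asHom u')).toIntLinearMap
  have hA : ∀ g, A g = End.asHom u ≫ g := fun g ↦ rfl
  have hB : ∀ g, B g = g ≫ End.asHom u' := fun g ↦ rfl
  have hApow : ∀ (n : ℕ) (g : X ⟶ Y), (A ^ n) g = End.asHom (u ^ n) ≫ g :=
    fun n g ↦ leftComp_pow_apply u n g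
  have hBpow : ∀ (n : ℕ) (g : X ⟶ Y), (B ^ n) g = g ≫ End.asHom (u' ^ n) :=
    fun n g ↦ rightComp_pow_apply u' n g
  have hAB : Commute A B := by
    change A * B = B * A
    refine LinearMap.ext fun g ↦ ?_
    rw [Module.End.mul_apply, Module.End.mul_apply, hA, hB, hA, hB, Category.assoc]
  have hfA : aeval A f = 0 := by
    refine LinearMap.ext fun g ↦ ?_
    rw [aeval_leftComp_apply, hf, LinearMap.zero_apply]
    exact Limits.zero_comp
  have hfB : aeval B f = 0 := by
    refine LinearMap.ext fun g ↦ ?_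
    rw [aeval_rightComp_apply, hf', LinearMap.zero_apply]
    exact Limits.comp_zero
  -- the operator `P = ∑_m f_m ∑_{j<m} A^j B^{m-1-j}` with `(A - B) P = f(A) - f(B) = 0`
  let E : ℕ → Module.End ℤ (X ⟶ Y) := fun m ↦ ∑ j ∈ Finset.range m, A ^ j * B ^ (m - 1 - j)
  let P : Module.End ℤ (X ⟶ Y) := ∑ m ∈ Finset.range (f.natDegree + 1), f.coeff m • E m
  have hPE : ∀ m, E m * (A - B) = A ^ m - B ^ m := fun m ↦ hAB.geom_sum₂_mul m
  have hcommE : ∀ m, Commute (A - B) (E m) := fun m ↦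
    Commute.sum_right _ _ _ fun j _ ↦
      ((Commute.refl A).sub_left hAB.symm).pow_right j |>.mul_right
        ((hAB.sub_left (Commute.refl B)).pow_right (m - 1 - j))
  have hP : (A - B) * P = 0 := by
    have hcomm : Commute (A - B) P :=
      Commute.sum_right _ _ _ fun m _ ↦ (hcommE m).smul_right (f.coeff m)
    rw [hcomm.eq]
    change (∑ m ∈ Finset.range (f.natDegree + 1), f.coeff m • E m) * (A - B) = 0
    rw [Finset.sum_mul]
    simp_rw [smul_mul_assoc, hPE, smul_sub, Finset.sum_sub_distrib]
    rw [← aeval_eq_sum_range, ← aeval_eq_sum_range, hfA, hfB, sub_zero]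
  -- `P h` commutes with `u, u'`
  have hequiv : End.asHom u ≫ P h = P h ≫ End.asHom u' := by
    have e := congrArg (fun T : Module.End ℤ (X ⟶ Y) ↦ T h) hP
    simp only [Module.End.mul_apply, LinearMap.sub_apply, LinearMap.zero_apply, hA, hB] at e
    exact sub_eq_zero.1 e
  -- `i ≫ P h = N • f'(u')`
  have hiE : ∀ m, i ≫ (E m) h = (N * m : ℤ) • End.asHom (u' ^ (m - 1)) := by
    intro m
    change i ≫ (∑ j ∈ Finset.range m, A ^ j * B ^ (m - 1 - j)) h = _
    rw [LinearMap.sum_apply, Preadditive.comp_sum]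
    have e : ∀ j ∈ Finset.range m, i ≫ (A ^ j * B ^ (m - 1 - j)) h =
        (N : ℤ) • End.asHom (u' ^ (m - 1)) := by
      intro j hj
      rw [Module.End.mul_apply, hBpow, hApow, ← Category.assoc, comp_asHom_pow_of_comp_eq hi,
        Category.assoc, ← Category.assoc i h, hih, Preadditive.nsmul_comp, Category.id_comp,
        Preadditive.comp_nsmul, asHom_pow_comp_asHom_pow, ← natCast_zsmul,
        show m - 1 - j + j = m - 1 by have := Finset.mem_range.1 hj; omega]
    rw [Finset.sum_congr rfl e, Finset.sum_const, Finset.card_range, ← natCast_zsmul, smul_smul,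
      mul_comm (m : ℤ)]
  have hdeg : (derivative f).natDegree < f.natDegree + 1 :=
    (natDegree_derivative_le f).trans_lt (by omega)
  have hiP : i ≫ P h = (N : ℤ) • End.asHom (aeval u' (derivative f)) := by
    change i ≫ (∑ m ∈ Finset.range (f.natDegree + 1), f.coeff m • E m) h = _
    rw [LinearMap.sum_apply, Preadditive.comp_sum]
    simp_rw [LinearMap.smul_apply, Preadditive.comp_zsmul, hiE, smul_smul]
    -- reindex: the `m = 0` term vanishes, `m = k + 1` gives `f_{k+1} (k+1) u'^k`
    rw [Finset.sum_range_succ', Nat.cast_zero, mul_zero, mul_zero, zero_smul, add_zero,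
      asHom_aeval_eq_sum u' (derivative f) hdeg, Finset.smul_sum, Finset.sum_range_succ,
      coeff_derivative, coeff_eq_zero_of_natDegree_lt (Nat.lt_succ_self _), zero_mul, zero_smul,
      smul_zero, add_zero]
    refine Finset.sum_congr rfl fun k _ ↦ ?_
    rw [coeff_derivative, smul_smul, Nat.add_sub_cancel]
    push_cast
    congr 1
    ring
  -- the equivariant quasi-retraction `h̃ = P h ≫ c_v(u')`
  refine ⟨P h ≫ End.asHom (aeval u' cv), ?_, ?_⟩
  · rw [← Category.assoc, hiP, Preadditive.zsmul_comp]
    change (N : ℤ) • End.asHom (aeval u' cv * aeval u' (derivative f)) = _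
    rw [← map_mul, show cv * derivative f = C D - cu * f by rw [← hD]; ring, map_sub, map_mul, hf',
      mul_zero, sub_zero, aeval_C, Algebra.algebraMap_eq_smul_one]
    change (N : ℤ) • (D • 𝟙 Y) = _
    rw [smul_smul]
  · rw [← Category.assoc, hequiv, Category.assoc, Category.assoc, asHom_aeval_comp_asHom]

/-! ### From a generator to the whole order -/

/-- **Equivariance for a generator implies equivariance for the order** (`Hom` is torsion-free,
Mumford §19 Thm. 3): if `h̃` commutes with `φ α`, `ψ α` for ring actions `φ : R →+* End X`,
`ψ : R →+* End Y` and every `r ∈ R` satisfies `m r = p(α)` for some integer `m ≠ 0` and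
`p ∈ ℤ[T]` (e.g. `R` an order of the number field `ℚ(α)`), then `h̃` commutes with all of `R`.
[cite: MumfordAV1970, §19 Thm. 3 (Hom is torsion-free)] -/
theorem comp_eq_comp_of_nsmul_generator {R : Type*} [CommRing R] (φ : R →+* End X)
    (ψ : R →+* End Y) (α : R) {h' : X ⟶ Y}
    (hα : End.asHom (φ α) ≫ h' = h' ≫ End.asHom (ψ α))
    (hgen : ∀ r : R, ∃ (m : ℕ) (p : ℤ[X]), m ≠ 0 ∧ (m : R) * r = aeval α p) (r : R) :
    End.asHom (φ r) ≫ h' = h' ≫ End.asHom (ψ r) := by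
  obtain ⟨m, p, hm, hr⟩ := hgen r
  -- `φ (p(α)) ≫ h' = h' ≫ ψ (p(α))` for every polynomial `p`
  have hpow : ∀ n : ℕ, End.asHom (φ (α ^ n)) ≫ h' = h' ≫ End.asHom (ψ (α ^ n)) := by
    intro n
    induction n with
    | zero =>
      rw [pow_zero, map_one, map_one]
      exact (Category.id_comp h').trans (Category.comp_id h').symm
    | succ n ih =>
      rw [pow_succ', map_mul, map_mul]
      change (End.asHom (φ (α ^ n)) ≫ End.asHom (φ α)) ≫ h' =
        h' ≫ (End.asHom (ψ (α ^ n)) ≫ End.asHom (ψ α))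
      rw [Category.assoc, hα, ← Category.assoc, ih, Category.assoc]
  have hpoly : End.asHom (φ (aeval α p)) ≫ h' = h' ≫ End.asHom (ψ (aeval α p)) := by
    rw [aeval_eq_sum_range, map_sum, map_sum]
    change Finset.sum _ (fun k ↦ End.asHom (φ (p.coeff k • α ^ k))) ≫ h' =
      h' ≫ Finset.sum _ (fun k ↦ End.asHom (ψ (p.coeff k • α ^ k)))
    rw [Preadditive.sum_comp, Preadditive.comp_sum]
    refine Finset.sum_congr rfl fun k _ ↦ ?_
    rw [map_zsmul, map_zsmul]
    change (p.coeff k • End.asHom (φ (α ^ k))) ≫ h' = h' ≫ (p.coeff k • End.asHom (ψ (α ^ k)))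
    rw [Preadditive.zsmul_comp, Preadditive.comp_zsmul, hpow]
  -- multiply the goal by `m` and cancel (`Hom` torsion-free)
  have hmr : m • (End.asHom (φ r) ≫ h') = m • (h' ≫ End.asHom (ψ r)) := by
    rw [← Preadditive.nsmul_comp, ← Preadditive.comp_nsmul]
    change End.asHom (m • φ r) ≫ h' = h' ≫ End.asHom (m • ψ r)
    rw [← map_nsmul, ← map_nsmul, nsmul_eq_mul, hr, hpoly]
  have h0 : m • (End.asHom (φ r) ≫ h' - h' ≫ End.asHom (ψ r)) = 0 := by
    rw [smul_sub, hmr, sub_self]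
  refine sub_eq_zero.1 ((isIsogeny_nsmul_id_of_ne_zero X hm).cancel_left ?_)
  simp only [Preadditive.nsmul_comp, Category.id_comp, Limits.comp_zero, h0]

end AbelianVariety

end Literature.AlgebraicGeometry.Motives
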